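/-
Copyright (c) 2026 the pub-hodgecm-mathlib formalisation cell (harness21).  Prover seat hodgecm-mathlib-K2E4-p13 (g0),
Track B «K2-LIT» ∕ h413, ENGINE E4 unit U6 `ArchLimitConstant` — brick (end-alg) of the G′ package of socket #9 `sig_K2E4ExplicitArchSingularTransfer`
(K2E4-p11 contract `K2E4ArchGPrimeSigs.contract.v1` 2f1b0eee520ac830, (end) = (end-read) ∘ (end-alg)).  2026-09-03.
-/
import Summits.HodgeConjecture.HodgeConjecture.Theorems.K2E4ArchGPrimeDefs                      -- ★ p855236 (K2E4-p11): `gState`, `stateMeasure`, `wallMeasure`, `wallCoef`, `datum`, `twoBlock`, `wallPoint`, `embCircle`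
import Summits.HodgeConjecture.HodgeConjecture.Theorems.K2E4ArchGPrimeLemmas                    -- ★ p855296 (K2E4-p11): `twoBlock_univ`, `datum_univ`, `stateMeasure_univ` (the `S = univ` readings)
import Summits.HodgeConjecture.HodgeConjecture.Theorems.K2E4ArchWallDeltaFactor                  -- ★ p854926 (this seat) G2: `archTransferFactor_cayleyTorus_relabel_eq_sign_mul`, `kappaSignProduct_ne_zero`
import Literature.NumberTheory.Rogawski1990.ArchStableOrbitalWallEndStateKappaSigned              -- ★ p855181 (this seat) (E-alg): κ-signed fibre sums are r-free; regrouping to the UNSIGNED stable sum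
import Literature.NumberTheory.Automorphic.ArchEndoscopicStableSumTorus                           -- ★ `archCongrOfEq_quasiSplitFrameTwo_symm_archDiagTorus` (assembler H-point → Cayley point)
import Literature.NumberTheory.Weil1964.UnitaryArchSingularTopFormFamily                          -- ★ Weil's singular top-form family `archSingularTopFormFamily`
import HarnessLib

/-!
# K2 · E4 · U6, brick (end-alg): the fully descended `G′`-state `gState … univ u` is an EXPLICIT non-zero multiple of the UNSIGNED top-form stable sum at the wall torus point,
# GIVEN the per-partner reading of the wall-measure integrals (Rogawski 1990 §8.2 Prop. 8.2.1 p. 118 «`Φ^κ(γ₀,f) = Φ(γ₀,f) + Φ(γ₀′,f)`», p. 124; Lemma 14.5.2 (b) pp. 238–239)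

Cell `pub/hodgecm-mathlib` (D-0151), HCML Track B, crux H413 = `stmt-HodgeConjecture-24833`; socket #9 `sig_K2E4ExplicitArchSingularTransfer` of
`Cruxes/H413/Lines/K2_E4_SingularTransferKappaSignSigsArchLimitConstant.lean` (assembler K2E4-p09 ★ p855083; G′ package K2E4-p11, structure `GPrimeData`, field `end_eq`).  K2E4-p11's contract
(end) `exists_gState_univ_eq` (`K2/K2E4-p11/g0/K2E4ArchGPrimeSigs.contract.v1.K2E4-p11-g0.lean`) is split (K2E4-p13 22:4xZ): **(end-read)** — ONE `r ≠ 0` with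
`∫ Θ d(⊗_v wallMeasure_v(ρ_v)) = r · Φ(⟦t(z⁰∘ρ)⟧, Θ∘coe; archSingularTopFormFamily ν)` for every `ρ` (★ (P1) + ★ (U) + the pinned references; p11∕p09) — and **(end-alg)** (THIS FILE): from that
reading, `gState … univ u = lam · Φ^{st}_∞(t z⁰, Θ∘coe; archSingularTopFormFamily ν)` with
`lam = χ · N⁻¹ · cT · Π_v Laurent_v(z⁰_v) · Π_v η_v · Π_v (2·p_v!(3−p_v)!·Π_i sgn re σ_v α_i) · r ≠ 0`.

THE MATHEMATICS.  At `S = univ` every place carries its wall measure and the datum is the wall point `z⁰ = (σe₁, σe₂, σe₁)` (`stateMeasure univ = wallMeasure`, `datum univ = wallPoint`), so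
`gState univ u = Σ_ρ χ N⁻¹ · T′.Δ(γ_H⁰, t(z⁰∘ρ)) · (Π_v wallCoef_v(ρ_v)) · ∫ Θ d(⊗_v wallMeasure_v(ρ_v))`, `u`-free.  The factor: `T′.Δ(γ_H⁰, t(z⁰∘ρ)) = K_ρ · cT · Π_v Laurent_v(z⁰_v)` (★ G2
`archTransferFactor_cayleyTorus_relabel_eq_sign_mul` after identifying the assembler's `H_∞`-point `(Ψ_{Q₂}⁻¹ t₂(σe₁,σe₁), e₁⁻¹ diag σe₂)` with the Cayley point `γ_H(z⁰)`, ★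
`archCongrOfEq_quasiSplitFrameTwo_symm_archDiagTorus`), `K_ρ = Π_v sgn(re σ_v α_{ρ_v⁻¹1})·η_v`.  The reading (end-read) makes each integral `r · Φ(⟦t(z⁰∘ρ)⟧)`.  Then the sum over `ρ` of
`(Π_v sgn_v(ρ_v)·wallCoef_v(ρ_v)) · Φ(⟦t(z⁰∘ρ)⟧)` is `(Π_v 2·p_v!(3−p_v)!·Π_i sgn α_i) · Φ^{st}(t z⁰)` — UNSIGNED — by ★ (E-alg) (`sum_filter_sign_mul_wallWeight_eq_two_mul_mul_prod_sign` with the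
`(−1)`-pinned coefficients `cst ≡ −1`, `mass ≡ 1`, `M ≡ 1`: the κ-sign cancels the Kottwitz sign class by class; ★ `…_of_fibre_const` regrouping).
HONEST LABEL: HC_CM is proved only modulo the 7 printed citations (2 remaining named inputs: hLiu418 = stmt-HodgeConjecture-24832, h413 = stmt-HodgeConjecture-24833) until rung 0 closes; this
file is algebra over ★ bricks and pays no socket by itself ((end) closes with (end-read)).

* §1 `relabelMultiplicity_ne_zero`; `hPoint_univ_eq_cayley` (the assembler's `H_∞`-point at `S = univ` IS the Cayley point `γ_H(z⁰)` of ★ G2 ∕ ★ (Δ-def-explicit); the `S = univ` readings of the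
  datum and the state measure are ★ `K2E4ArchGPrimeLemmas.datum_univ` ∕ `stateMeasure_univ`).
* §2 **`exists_gState_univ_eq_of_wallIntegral`** — (end-alg).

## References
* [Rogawski1990] J. D. Rogawski, *Automorphic Representations of Unitary Groups in Three Variables*, Ann. of Math. Stud. 123 (1990), §8.2 Prop. 8.2.1 (a) p. 118, proof pp. 118–119, p. 124;
  §14.5 Lemma 14.5.2 (b) pp. 238–239; §14.6 p. 242; §4.1 (4.1.2) p. 39.
-/

set_option autoImplicit false
set_option linter.dupNamespace false  -- the cell's namespace convention `Summit.HodgeConjecture.HodgeConjecture.Cruxes.H413.<File>` repeats the summit = problem name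

noncomputable section

open MeasureTheory Measure Filter Topology NumberField NumberField.InfinitePlace NumberField.mixedEmbedding Equiv Function Set
open Literature.MeasureTheory.Group Literature.NumberTheory.Automorphic Literature.NumberTheory.Automorphic.UnitaryGroup
open Literature.LinearAlgebra.Matrix Literature.NumberTheory.Rogawski1990 Literature.NumberTheory.GaloisRepresentations
open Summit.HodgeConjecture.HodgeConjecture.Cruxes.H413.K2E4ArchGPrimeDefs Summit.HodgeConjecture.HodgeConjecture.Cruxes.H413.K2E4ArchWallDeltaFactor
open scoped Matrix MatrixGroups Matrix.Norms.Operator ContDiff ENNReal Classical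

namespace Summit.HodgeConjecture.HodgeConjecture.Cruxes.H413.K2E4ArchGPrimeEndAlg

variable (L : Type) [Field L] [NumberField L] [IsCMField L] (α : Fin 3 → L)

/-! ## §1 The multiplicity and the `H_∞`-point at `S = univ` -/

omit [IsCMField L] in
/-- The relabelling multiplicity is non-zero (the identity relabelling preserves every `P_v`). [cite: Rogawski1990, §4.1 (4.1.1) p. 39] -/
theorem relabelMultiplicity_ne_zero : relabelMultiplicity L α ≠ 0 := by
  unfold relabelMultiplicity
  refine Finset.card_ne_zero.2 ⟨fun _ => 1, Finset.mem_filter.2 ⟨Finset.mem_univ _, fun v => ?_⟩⟩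
  simp only [Equiv.Perm.coe_one, Finset.image_id]

section Frame

variable [MeasurableSpace (GL (Fin 3) ℂ)] [BorelSpace (GL (Fin 3) ℂ)]
  (νw : ∀ v : {w : InfinitePlace L // IsComplex w}, Measure (archLocal L 3 (Matrix.diagonal α) v)) (hνw : ∀ v, (νw v).IsHaarMeasure ∧ (νw v).IsMulRightInvariant)
  (e₁ e₂ : L) (h₁ : (IsCMField.complexConj L e₁ : L) * e₁ = 1) (h₂ : (IsCMField.complexConj L e₂ : L) * e₂ = 1) (hne : e₁ ≠ e₂)
  [∀ (w : {w : InfinitePlace L // IsComplex w}) (τ : Perm (Fin 3)), MeasurableSpace (archLocal L 3 (Matrix.diagonal (α ∘ ⇑τ)) w ⧸ Subgroup.centralizer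
    ({(⟨circleDiagonal 3 (wallPoint L e₁ e₂ h₁ h₂ w), circleDiagonal_mem_archLocal_diagonal L 3 (α ∘ ⇑τ) w (wallPoint L e₁ e₂ h₁ h₂ w)⟩ : archLocal L 3 (Matrix.diagonal (α ∘ ⇑τ)) w)} :
      Set (archLocal L 3 (Matrix.diagonal (α ∘ ⇑τ)) w)))]
  [∀ (w : {w : InfinitePlace L // IsComplex w}) (τ : Perm (Fin 3)), BorelSpace (archLocal L 3 (Matrix.diagonal (α ∘ ⇑τ)) w ⧸ Subgroup.centralizer
    ({(⟨circleDiagonal 3 (wallPoint L e₁ e₂ h₁ h₂ w), circleDiagonal_mem_archLocal_diagonal L 3 (α ∘ ⇑τ) w (wallPoint L e₁ e₂ h₁ h₂ w)⟩ : archLocal L 3 (Matrix.diagonal (α ∘ ⇑τ)) w)} :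
      Set (archLocal L 3 (Matrix.diagonal (α ∘ ⇑τ)) w)))]
  (νH : ∀ (w : {w : InfinitePlace L // IsComplex w}) (τ : Perm (Fin 3)), Measure (Subgroup.centralizer
    ({(⟨circleDiagonal 3 (wallPoint L e₁ e₂ h₁ h₂ w), circleDiagonal_mem_archLocal_diagonal L 3 (α ∘ ⇑τ) w (wallPoint L e₁ e₂ h₁ h₂ w)⟩ : archLocal L 3 (Matrix.diagonal (α ∘ ⇑τ)) w)} :
      Set (archLocal L 3 (Matrix.diagonal (α ∘ ⇑τ)) w))))
  (hνH : ∀ w τ, (νH w τ).IsHaarMeasure ∧ (νH w τ).IsInvInvariant)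

omit [MeasurableSpace (GL (Fin 3) ℂ)] [BorelSpace (GL (Fin 3) ℂ)] in
/-- **The assembler's `H_∞`-point at `S = univ` IS the Cayley point of the wall datum**: `(Ψ_{Q₂}⁻¹ t₂(σe₁, σe₁), e₁⁻¹ diag(σe₂)) = γ_H(z⁰)` with the Cayley family of ★ (Δ-def-explicit)
(★ `archCongrOfEq_quasiSplitFrameTwo_symm_archDiagTorus`; slots `0, 2` of `z⁰` are `σe₁`, slot `1` is `σe₂`). [cite: Rogawski1990, §8.2 p. 118; §14.3 p. 234] -/
theorem hPoint_univ_eq_cayley (u : {w : InfinitePlace L // IsComplex w} → Fin 2 → Circle) :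
    (((unitaryGroupOfFormCongrOfEq (UnitaryGroup.conjMixed (↥(maximalRealSubfield L)) L (IsCMField.complexConj L))
          (Matrix.GeneralLinearGroup.map (mixedEmbedding L) (Matrix.GeneralLinearGroup.mkOfDetNeZero !![(1 : L), 1; 1, -1] (UnitaryGroup.det_quasiSplitFrameTwo_ne_zero L)))
          (UnitaryGroup.archFormOf L 2 (Matrix.diagonal ![(2 : L)⁻¹, -(2 : L)⁻¹])) (UnitaryGroup.archFormOf L 2 (Matrix.of fun i j : Fin 2 => if i.val + j.val + 1 = 2 then (1 : L) else 0))
          (UnitaryGroup.formCongr_map_mixedEmbedding_archFormOf_eq L (UnitaryGroup.formCongr_quasiSplitFrameTwo_diagonal L))).symm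
          (UnitaryGroup.archDiagTorus L 2 ![(2 : L)⁻¹, -(2 : L)⁻¹] (twoBlock L e₁ h₁ Finset.univ u)),
        (UnitaryGroup.archPiEquivCM 1 L (Matrix.of fun i j : Fin 1 => if i.val + j.val + 1 = 1 then (1 : L) else 0)).symm fun w =>
          ⟨UnitaryGroup.circleDiagonal 1 ![embCircle L e₂ h₂ w], UnitaryGroup.circleDiagonal_mem_archLocal_antidiagOne L w _⟩) :
        ↥(UnitaryGroup.arch (↥(maximalRealSubfield L)) L (IsCMField.complexConj L) 2 (Matrix.of fun i j : Fin 2 => if i.val + j.val + 1 = 2 then (1 : L) else 0)) ×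
          ↥(UnitaryGroup.arch (↥(maximalRealSubfield L)) L (IsCMField.complexConj L) 1 (Matrix.of fun i j : Fin 1 => if i.val + j.val + 1 = 1 then (1 : L) else 0))) =
      (fun z : {w : InfinitePlace L // IsComplex w} → Fin 3 → Circle =>
        ((UnitaryGroup.archPiEquivCM 2 L (Matrix.of fun i j : Fin 2 => if i.val + j.val + 1 = 2 then (1 : L) else 0)).symm fun w =>
            ⟨Matrix.GeneralLinearGroup.mkOfDetNeZero !![(1 : ℂ), 1; 1, -1] UnitaryGroup.det_cayleyTwo_ne_zero *
                UnitaryGroup.circleDiagonal 2 ![z w 0, z w 2] *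
              (Matrix.GeneralLinearGroup.mkOfDetNeZero !![(1 : ℂ), 1; 1, -1] UnitaryGroup.det_cayleyTwo_ne_zero)⁻¹,
              UnitaryGroup.cayley_conj_circleDiagonal_mem_archLocal L w _⟩,
          (UnitaryGroup.archPiEquivCM 1 L (Matrix.of fun i j : Fin 1 => if i.val + j.val + 1 = 1 then (1 : L) else 0)).symm fun w =>
            ⟨UnitaryGroup.circleDiagonal 1 ![z w 1], UnitaryGroup.circleDiagonal_mem_archLocal_antidiagOne L w _⟩))
        (wallPoint L e₁ e₂ h₁ h₂) := by
  rw [K2E4ArchGPrimeLemmas.twoBlock_univ, archCongrOfEq_quasiSplitFrameTwo_symm_archDiagTorus]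
  rfl

/-! ## §2 (end-alg) -/

variable [MeasurableSpace (arch (↥(maximalRealSubfield L)) L (IsCMField.complexConj L) 3 (Matrix.diagonal α))]
  [BorelSpace (arch (↥(maximalRealSubfield L)) L (IsCMField.complexConj L) 3 (Matrix.diagonal α))]
  [∀ γ : arch (↥(maximalRealSubfield L)) L (IsCMField.complexConj L) 3 (Matrix.diagonal α), MeasurableSpace (arch (↥(maximalRealSubfield L)) L (IsCMField.complexConj L) 3 (Matrix.diagonal α) ⧸ Subgroup.centralizer ({γ} : Set (arch (↥(maximalRealSubfield L)) L (IsCMField.complexConj L) 3 (Matrix.diagonal α))))]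
  [∀ γ : arch (↥(maximalRealSubfield L)) L (IsCMField.complexConj L) 3 (Matrix.diagonal α), BorelSpace (arch (↥(maximalRealSubfield L)) L (IsCMField.complexConj L) 3 (Matrix.diagonal α) ⧸ Subgroup.centralizer ({γ} : Set (arch (↥(maximalRealSubfield L)) L (IsCMField.complexConj L) 3 (Matrix.diagonal α))))]
  (ν : Measure (arch (↥(maximalRealSubfield L)) L (IsCMField.complexConj L) 3 (Matrix.diagonal α))) [IsFiniteMeasureOnCompacts ν] [ν.IsMulRightInvariant]
  (χ : ℝ≥0∞)
  (T' : ArchTransferFactor L (Matrix.diagonal α)) (μω : HeckeCharacter L)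
  (hμω : ∀ x : ideleGroup ↥(maximalRealSubfield L), μω (AdeleRing.ideleBaseChange (↥(maximalRealSubfield L)) L x) = quadraticHeckeCharCM L x)
  (cT : ℂ) (hT : ∀ a b, T'.Δ a b = cT * archExplicitDelta L (Matrix.diagonal α) a μω b)

include hμω hT in
/-- **(end-alg) — THE FULLY DESCENDED `G′`-STATE IS AN EXPLICIT NON-ZERO MULTIPLE OF THE UNSIGNED TOP-FORM STABLE SUM, GIVEN THE WALL-INTEGRAL READING.**  Hypotheses: the frame guards
`hα`, `hherm`; `χ ≠ 0, ∞`; `cT ≠ 0`; and ONE constant `r ≠ 0` reading EVERY partner's wall-measure integral as `r · Φ(⟦t(z⁰∘ρ)⟧, Θ∘coe; archSingularTopFormFamily ν)` ((end-read): ★ (P1) +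
★ (U) + the `(−1)`-pinned references, K2E4-p11∕p09).  Conclusion: ONE `lam ≠ 0` (explicitly `χ·N⁻¹·cT·Π_v Laurent_v(z⁰_v)·Π_v η_v·Π_v(2·p_v!(3−p_v)!·Π_i sgn re σ_v α_i)·r`) with
`gState … T′ χ Θ univ u = lam · Φ^{st}_∞(t z⁰, Θ∘coe; archSingularTopFormFamily ν)` for every continuous compactly supported `Θ` and every `u` — the field `end_eq` of `GPrimeData`
modulo (end-read).  The κ-sign of the transfer factor CANCELS the Kottwitz sign of the wall coefficients (★ (E-alg)): the end state is the UNSIGNED stable sum, print's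
«`Φ^κ(γ₀, f) = Φ(γ₀, f) + Φ(γ₀′, f)`». [cite: Rogawski1990, §8.2 Prop. 8.2.1 (a) p. 118, p. 124; §14.5 Lemma 14.5.2 (b) pp. 238–239; §14.6 p. 242] -/
theorem exists_gState_univ_eq_of_wallIntegral
    (hα : ∀ i, α i ≠ 0) (hherm : ∀ i, (IsCMField.complexConj L (α i) : L) = α i) (hχ0 : χ ≠ 0) (hχ : χ ≠ ⊤) (hcT : cT ≠ 0)
    (r : ℂ) (hr : r ≠ 0)
    (hread : ∀ (Θ : Matrix (Fin 3) (Fin 3) (mixedSpace L) → ℂ), Continuous Θ →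
      HasCompactSupport (fun g : arch (↥(maximalRealSubfield L)) L (IsCMField.complexConj L) 3 (Matrix.diagonal α) => Θ ((g : GL (Fin 3) (mixedSpace L)) : Matrix (Fin 3) (Fin 3) (mixedSpace L))) →
      ∀ ρ : {w : InfinitePlace L // IsComplex w} → Perm (Fin 3),
        ∫ o, Θ ((((archPiEquivCM 3 L (Matrix.diagonal α)).symm o : arch (↥(maximalRealSubfield L)) L (IsCMField.complexConj L) 3 (Matrix.diagonal α)) :
            GL (Fin 3) (mixedSpace L)) : Matrix (Fin 3) (Fin 3) (mixedSpace L))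
          ∂(Measure.pi fun v => wallMeasure L α νw hνw e₁ e₂ h₁ h₂ hne νH hνH v (ρ v)) =
        r * classOrbitalIntegral (Literature.NumberTheory.Weil1964.UnitaryArchTopForm.archSingularTopFormFamily L (Matrix.diagonal α) ν)
          (fun g : arch (↥(maximalRealSubfield L)) L (IsCMField.complexConj L) 3 (Matrix.diagonal α) => Θ ((g : GL (Fin 3) (mixedSpace L)) : Matrix (Fin 3) (Fin 3) (mixedSpace L)))
          (ConjClasses.mk (archDiagTorus L 3 α fun v => wallPoint L e₁ e₂ h₁ h₂ v ∘ ⇑(ρ v)))) :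
    ∃ lam : ℂ, lam ≠ 0 ∧ ∀ (Θ : Matrix (Fin 3) (Fin 3) (mixedSpace L) → ℂ), Continuous Θ →
      HasCompactSupport (fun g : arch (↥(maximalRealSubfield L)) L (IsCMField.complexConj L) 3 (Matrix.diagonal α) => Θ ((g : GL (Fin 3) (mixedSpace L)) : Matrix (Fin 3) (Fin 3) (mixedSpace L))) →
      ∀ u : {w : InfinitePlace L // IsComplex w} → Fin 2 → Circle,
        gState L α νw hνw e₁ e₂ h₁ h₂ hne νH hνH T' χ Θ Finset.univ u =
          lam * archStableOrbitalIntegral L 3 (Matrix.diagonal α) (Literature.NumberTheory.Weil1964.UnitaryArchTopForm.archSingularTopFormFamily L (Matrix.diagonal α) ν)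
            (fun g : arch (↥(maximalRealSubfield L)) L (IsCMField.complexConj L) 3 (Matrix.diagonal α) => Θ ((g : GL (Fin 3) (mixedSpace L)) : Matrix (Fin 3) (Fin 3) (mixedSpace L)))
            (archDiagTorus L 3 α (wallPoint L e₁ e₂ h₁ h₂)) := by
  have hreal : ∀ (v : {w : InfinitePlace L // IsComplex w}) (i : Fin 3), (v.1.embedding (α i)).im = 0 :=
    fun v i => im_embedding_eq_zero_of_complexConj_eq L v (hherm i)
  -- ★ (Δ-def-explicit): the exponents `k` and the transfer factor on the Cayley family
  obtain ⟨k, hk⟩ := exists_archExplicitDelta_cayleyTorus_relabel_eq_prod L α _ rfl μω hμω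
  -- the constants
  set σ0 : ℂ := cT * ∏ v : {w : InfinitePlace L // IsComplex w},
      -((((wallPoint L e₁ e₂ h₁ h₂ v 0 : ℂ) * (wallPoint L e₁ e₂ h₁ h₂ v 2 : ℂ)) ^ (k v)) *
        (((wallPoint L e₁ e₂ h₁ h₂ v 1 : ℂ) - (wallPoint L e₁ e₂ h₁ h₂ v 0 : ℂ)) * ((wallPoint L e₁ e₂ h₁ h₂ v 1 : ℂ) - (wallPoint L e₁ e₂ h₁ h₂ v 2 : ℂ))) / (wallPoint L e₁ e₂ h₁ h₂ v 1 : ℂ)) with hσ0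
  set ηP : ℂ := ∏ v : {w : InfinitePlace L // IsComplex w}, ((archMajoritySign L (Matrix.diagonal α) v : ℤ) : ℂ) with hηP
  set Λ : {w : InfinitePlace L // IsComplex w} → ℂ := fun v => (2 : ℂ) * (1 : ℝ) * ((Finset.univ.filter fun i => 0 < (v.1.embedding (α i)).re).card.factorial *
      (3 - (Finset.univ.filter fun i => 0 < (v.1.embedding (α i)).re).card).factorial : ℕ) * ∏ i : Fin 3, (((SignType.sign ((v.1.embedding (α i)).re) : ℤ)) : ℂ) with hΛ
  have hσ0ne : σ0 ≠ 0 := by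
    refine mul_ne_zero hcT (Finset.prod_ne_zero_iff.2 fun v _ => ?_)
    have h01 : (wallPoint L e₁ e₂ h₁ h₂ v 1 : ℂ) ≠ (wallPoint L e₁ e₂ h₁ h₂ v 0 : ℂ) := fun h => wallPoint_zero_ne_one L e₁ e₂ h₁ h₂ hne v (Circle.ext h).symm
    have h21 : (wallPoint L e₁ e₂ h₁ h₂ v 1 : ℂ) ≠ (wallPoint L e₁ e₂ h₁ h₂ v 2 : ℂ) := fun h =>
      wallPoint_zero_ne_one L e₁ e₂ h₁ h₂ hne v ((wallPoint_zero_eq_two L e₁ e₂ h₁ h₂ v).trans (Circle.ext h).symm)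
    exact neg_ne_zero.2 (div_ne_zero (mul_ne_zero (zpow_ne_zero _ (mul_ne_zero (Circle.coe_ne_zero _) (Circle.coe_ne_zero _)))
      (mul_ne_zero (sub_ne_zero.2 h01) (sub_ne_zero.2 h21))) (Circle.coe_ne_zero _))
  have hηPne : ηP ≠ 0 := Finset.prod_ne_zero_iff.2 fun v _ => Int.cast_ne_zero.2 (archMajoritySign_ne_zero L (Matrix.diagonal α) v)
  have hΛne : ∀ v, Λ v ≠ 0 := fun v => by
    refine mul_ne_zero (mul_ne_zero (mul_ne_zero two_ne_zero (by norm_num)) (by exact_mod_cast Nat.mul_ne_zero (Nat.factorial_ne_zero _) (Nat.factorial_ne_zero _)))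
      (Finset.prod_ne_zero_iff.2 fun i _ => ?_)
    rw [Int.cast_ne_zero]
    rcases (re_embedding_ne_zero L 3 α v hα (hreal v) i).lt_or_gt with h | h
    · rw [sign_neg h]; decide
    · rw [sign_pos h]; decide
  have hNne : ((relabelMultiplicity L α : ℕ) : ℂ) ≠ 0 := Nat.cast_ne_zero.2 (relabelMultiplicity_ne_zero L α)
  have hχne : ((χ.toReal : ℝ) : ℂ) ≠ 0 := Complex.ofReal_ne_zero.2 (ENNReal.toReal_ne_zero.2 ⟨hχ0, hχ⟩)
  refine ⟨(χ.toReal : ℂ) * ((relabelMultiplicity L α : ℕ) : ℂ)⁻¹ * σ0 * ηP * r * ∏ v, Λ v,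
    mul_ne_zero (mul_ne_zero (mul_ne_zero (mul_ne_zero (mul_ne_zero hχne (inv_ne_zero hNne)) hσ0ne) hηPne) hr) (Finset.prod_ne_zero_iff.2 fun v _ => hΛne v), ?_⟩
  intro Θ hΘ hΘc u
  -- the per-`ρ` summand at `S = univ`
  have hterm : ∀ ρ : {w : InfinitePlace L // IsComplex w} → Perm (Fin 3),
      (χ.toReal : ℂ) * ((relabelMultiplicity L α : ℕ) : ℂ)⁻¹ *
        T'.Δ ((unitaryGroupOfFormCongrOfEq (UnitaryGroup.conjMixed (↥(maximalRealSubfield L)) L (IsCMField.complexConj L))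
              (Matrix.GeneralLinearGroup.map (mixedEmbedding L) (Matrix.GeneralLinearGroup.mkOfDetNeZero !![(1 : L), 1; 1, -1] (UnitaryGroup.det_quasiSplitFrameTwo_ne_zero L)))
              (UnitaryGroup.archFormOf L 2 (Matrix.diagonal ![(2 : L)⁻¹, -(2 : L)⁻¹])) (UnitaryGroup.archFormOf L 2 (Matrix.of fun i j : Fin 2 => if i.val + j.val + 1 = 2 then (1 : L) else 0))
              (UnitaryGroup.formCongr_map_mixedEmbedding_archFormOf_eq L (UnitaryGroup.formCongr_quasiSplitFrameTwo_diagonal L))).symm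
              (UnitaryGroup.archDiagTorus L 2 ![(2 : L)⁻¹, -(2 : L)⁻¹] (twoBlock L e₁ h₁ Finset.univ u)),
            (UnitaryGroup.archPiEquivCM 1 L (Matrix.of fun i j : Fin 1 => if i.val + j.val + 1 = 1 then (1 : L) else 0)).symm fun w =>
              ⟨UnitaryGroup.circleDiagonal 1 ![embCircle L e₂ h₂ w], UnitaryGroup.circleDiagonal_mem_archLocal_antidiagOne L w _⟩)
          (UnitaryGroup.archDiagTorus L 3 α fun v => datum L e₁ e₂ h₁ h₂ Finset.univ u v ∘ ⇑(ρ v)) *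
        (∏ v ∈ Finset.univ, wallCoef L α v (ρ v)) *
        ∫ o, Θ ((((archPiEquivCM 3 L (Matrix.diagonal α)).symm o : arch (↥(maximalRealSubfield L)) L (IsCMField.complexConj L) 3 (Matrix.diagonal α)) :
            GL (Fin 3) (mixedSpace L)) : Matrix (Fin 3) (Fin 3) (mixedSpace L))
          ∂(Measure.pi (stateMeasure L α νw hνw e₁ e₂ h₁ h₂ hne νH hνH Finset.univ u ρ)) =
      ((χ.toReal : ℂ) * ((relabelMultiplicity L α : ℕ) : ℂ)⁻¹ * σ0 * ηP * r) *
        ((∏ v, ((SignType.sign ((v.1.embedding (α ((ρ v).symm 1))).re) : ℤ) : ℂ) * wallCoef L α v (ρ v)) *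
          classOrbitalIntegral (Literature.NumberTheory.Weil1964.UnitaryArchTopForm.archSingularTopFormFamily L (Matrix.diagonal α) ν)
            (fun g : arch (↥(maximalRealSubfield L)) L (IsCMField.complexConj L) 3 (Matrix.diagonal α) => Θ ((g : GL (Fin 3) (mixedSpace L)) : Matrix (Fin 3) (Fin 3) (mixedSpace L)))
            (ConjClasses.mk (archDiagTorus L 3 α fun v => wallPoint L e₁ e₂ h₁ h₂ v ∘ ⇑(ρ v)))) := by
    intro ρ
    rw [K2E4ArchGPrimeLemmas.stateMeasure_univ, hread Θ hΘ hΘc ρ, K2E4ArchGPrimeLemmas.datum_univ, hPoint_univ_eq_cayley,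
      archTransferFactor_cayleyTorus_relabel_eq_sign_mul L α _ μω T' cT hT k hk (wallPoint L e₁ e₂ h₁ h₂) ρ]
    rw [Int.cast_prod]
    simp only [Int.cast_mul, Finset.prod_mul_distrib]
    ring
  -- ★ (E-alg): the κ-signed regrouping with the `(−1)`-pinned coefficients (`cst ≡ −1`, `mass ≡ 1`, `M ≡ 1`)
  have hwt : ∀ (v : {w : InfinitePlace L // IsComplex w}) (σ : Perm (Fin 3)),
      ((SignType.sign ((v.1.embedding (α (σ.symm 1))).re) : ℤ) : ℂ) * wallCoef L α v σ =
        (((SignType.sign ((v.1.embedding (α (σ.symm 1))).re) : ℤ) : ℂ) *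
          ((if 0 < (v.1.embedding (α (σ⁻¹ 0))).re * (v.1.embedding (α (σ⁻¹ 2))).re then (2 : ℂ) else (fun _ : Perm (Fin 3) => -((1 : ℝ) : ℂ)) σ) *
            (((if 0 < (v.1.embedding (α (σ⁻¹ 0))).re * (v.1.embedding (α (σ⁻¹ 2))).re then (fun _ : Perm (Fin 3) => (1 : NNReal)) σ else 1 : NNReal) : ℝ) : ℂ))) := by
    intro v σ
    simp only [wallCoef]
    split_ifs <;> simp
  have hsum := sum_univ_prod_mul_classOrbitalIntegral_mk_archDiagTorus_comp_eq_prod_mul_archStableOrbitalIntegral_of_fibre_const L 3 α hα hherm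
    (fun v => wallPoint L e₁ e₂ h₁ h₂ v)
    (fun v σ => ((SignType.sign ((v.1.embedding (α (σ.symm 1))).re) : ℤ) : ℂ) * wallCoef L α v σ) Λ
    (fun v r' => by
      rw [Finset.sum_congr rfl fun σ _ => hwt v σ]
      exact sum_filter_sign_mul_wallWeight_eq_two_mul_mul_prod_sign L α v hα (hreal v) (wallPoint_zero_eq_two L e₁ e₂ h₁ h₂ v) (wallPoint_zero_ne_one L e₁ e₂ h₁ h₂ hne v)
        (fun _ => -((1 : ℝ) : ℂ)) (fun _ => (1 : NNReal)) (1 : ℝ) (fun _ _ => rfl) (fun _ _ => NNReal.coe_one) r')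
    (Literature.NumberTheory.Weil1964.UnitaryArchTopForm.archSingularTopFormFamily L (Matrix.diagonal α) ν)
    (fun g : arch (↥(maximalRealSubfield L)) L (IsCMField.complexConj L) 3 (Matrix.diagonal α) => Θ ((g : GL (Fin 3) (mixedSpace L)) : Matrix (Fin 3) (Fin 3) (mixedSpace L)))
  unfold gState
  rw [Finset.sum_congr rfl fun ρ _ => hterm ρ, ← Finset.mul_sum, hsum]
  ring

end Frame

end Summit.HodgeConjecture.HodgeConjecture.Cruxes.H413.K2E4ArchGPrimeEndAlg

end
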